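import Literature.Computability.Complexity.PlethysmStabilityBIP
import Literature.Computability.Complexity.OccurrenceObstructionsHooksProofs
import HarnessLib

/-!
# BIP 2019 §5 and §7 AS PRINTED: the isomorphism halves of Props. 5.6/5.8 (plethysm stability)
# and Prop. 7.2 (val-lit cell, DAG row BIP19-B; typed literature; §3–§4: `BIP19Plethysms.lean`)

Source: P. Bürgisser, C. Ikenmeyer, G. Panova, *No occurrence obstructions in geometric complexity
theory*, J. Amer. Math. Soc. 32 (2019) 163–193 = arXiv:1604.06431v3 [key
`BurgisserIkenmeyerPanovaJAMS2019`]; numbering = the journal's = the v3 TeX section counters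
(`[tex:1604.06431 Lnnn]` = line of `pub-gct/inputs/files/src/1604.06431/main.tex`); the held text
`paper:arxiv-1604.06431` is arXiv v1 with FLAT numbering (Prop. 24 = Prop. 5.6, Prop. 29 =
Prop. 5.8, Prop. 36 = Prop. 7.2), whose locators are given as well.

The tree has BIP §5 in the DUAL picture of `PlethysmLifting.lean`/`PlethysmStability.lean`
(`innerLift` = `(κ^d_{m,n})^*`-transport on polynomial functions, Lemma 5.1 definitional, Lemma 5.2
`formCoeff_iterPderiv_X_pow_mul`, Lemma 5.3 `innerLift_mem_highestWeightSpace`, Thm. 5.4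
`aeval_formCoeff_innerLift`) and the SURJECTIVITY halves Prop. 5.6(2), Prop. 5.8(2) as named facts
`Literature.Computability.Complexity.bip2019_prop_5_6_2`/`bip2019_prop_5_8_2`, both DISCHARGED
(`PlethysmStabilityBIP.lean`). This file adds, in exactly the vocabulary of those two facts
(`V = ℂ^{N×N}`, highest weights `partitionWeightLex N λ`, forms of degree `d` of
`ℂ[Sym^n] = MvPolynomial (DegIdx (MatIdx N) n) ℂ`), the printed statements the tree lacks:

* `bip2019_prop_5_6_1` — **Prop. 5.6(1)**: for `μ ⊢ md` with `μ₂ ≤ m` and `n ≥ m`, the inner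
  lifting is an ISOMORPHISM `HWV_μ(Sym^d Sym^m V) → HWV_{μ♯dn}(Sym^d Sym^n V)` — as the equality
  `innerLift (HWV_μ) = HWV_{μ♯dn}` of submodules for the injective (`innerLift_injective`) dual
  lifting; with the stability corollary `bip2019_prop_5_6_1_finrank` (`a_μ(d[m]) = a_{μ♯dn}(d[n])`,
  "the multiplicity `a_μ(d[m])` does not increase", §5 intro). PROVED from Lemma 5.3 and the
  discharged Prop. 5.6(2).
* `bip2019_prop_5_8_1` — **Prop. 5.8(1)**: for `ν ⊢ mk` with `ν₂ + |ν̄| ≤ k ≤ d`, multiplication by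
  `(e_1^m)^{d-k}` (the coordinate `X_{x_top^m}` of `ℂ[Sym^m]`, `topDegIdx`) is an ISOMORPHISM
  `HWV_ν(Sym^k Sym^m V) → HWV_{ν♯dm}(Sym^d Sym^m V)`; corollary `bip2019_prop_5_8_1_finrank`.
  PROVED from `mul_mem_highestWeightSpace_coordRep`, `X_mem_highestWeightSpace_coordRep` and the
  discharged Prop. 5.8(2).
* `bip2019_prop_7_2` — **Prop. 7.2** (positivity of `a_ν(d[n])` for the hook-like shapes with a
  short column, `t ≥ r`), a named fact in the format of the sibling
  `Literature.Computability.Complexity.bip2019_prop_7_3`, DISCHARGED here (`bip2019_prop_7_2_holds`)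
  by the printed tableau of Figure 1 read as a block design for the tree's generic
  `Literature.Computability.Complexity.exists_hwv_hookPartition_of_design`. Net new facts: 0.

`HWV_λ(Sym^d Sym^n V)` is rendered as the submodule `hwvForms N n d λ :=
(forms of degree d) ⊓ (highest-weight space of weight λ^*)` of `ℂ[Sym^n]` (the two LCC facts carry
the degree as the hypothesis `IsHomogeneous d`; a weight pins the degree only for `n ≠ 0`).
"`λ = μ♯dn`" (first row extended) is rendered, as in the two facts, by EQUAL BODIES `λ̄ = μ̄`
(`parts.erase parts.sup`) together with the sizes `|μ| = dm`, `|λ| = dn`; a partition is determined by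
its size and its body (private lemma `partition_eq_of_erase_sup_eq`).

Deliberately NOT typed (objects absent; recorded in the val-lit crosswalk): Thm. 5.5 and Lemma 5.7
(`κ(v_T) = v_{T'}`, `(e_1^m)^{d-k}·v_T = v_{T''}` — the tree's proofs of 5.6(2)/5.8(2) go through
SUPPORTS, `le_apply_add_of_mem_highestWeightSpace_coordRep`, not through tableau liftings).
Typed literature; VP ≠ VNP is NOT proved and nothing here is progress on it.

## References

* [BurgisserIkenmeyerPanovaJAMS2019] BIP, J. AMS 32 (2019) = arXiv:1604.06431v3: §5 intro
  [tex L1591–1605], Prop. 5.6 [tex L1898–1913], (5.8) [tex L1955–1963], Prop. 5.8 [tex L2026–2042],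
  Prop. 7.2 [tex L2529–2532] and its proof [tex L2533–2622]; held v1 text: Prop. 24 p0014.txt:L99,
  Prop. 29 p0017.txt:L3, Prop. 36 p0021.txt:L76.
-/

open MvPolynomial
open scoped BigOperators

namespace Literature.Computability.AlgebraicComplexity

open Literature.NumberTheory.DiophantineGeometry Literature.Computability.Complexity

/-! ### Bookkeeping: bodies determine partitions; degree-`d` highest-weight forms -/

section Bookkeeping

/-- A partition is determined by its size and its body: two partitions of the same `n` whose
multisets of parts agree after removing one copy of the largest part are equal (the largest parts
are then `n - |body|` on both sides). Used to identify the `μ` with `μ̄ = λ̄` produced by the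
tree's Prop. 5.6(2)/5.8(2) with a given one. [folklore] -/
private theorem partition_eq_of_erase_sup_eq {n : ℕ} {μ μ' : Nat.Partition n}
    (h : μ.parts.erase μ.parts.sup = μ'.parts.erase μ'.parts.sup) : μ = μ' := by
  have hb : bodySize μ = bodySize μ' := by
    rw [← sum_erase_sup_eq_bodySize, ← sum_erase_sup_eq_bodySize, h]
  have h1 := sup_add_bodySize μ
  have h1' := sup_add_bodySize μ'
  have hsup : μ.parts.sup = μ'.parts.sup := by omega
  ext1
  by_cases h0 : μ.parts = 0
  · have hn : n = 0 := by rw [← μ.parts_sum, h0, Multiset.sum_zero]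
    rw [h0, parts_eq_zero_of_eq_zero μ' hn]
  · have h0' : μ'.parts ≠ 0 := by
      intro h0'
      have hn : n = 0 := by rw [← μ'.parts_sum, h0', Multiset.sum_zero]
      exact h0 (parts_eq_zero_of_eq_zero μ hn)
    rw [← Multiset.cons_erase (sup_mem_of_ne_zero h0), ← Multiset.cons_erase (sup_mem_of_ne_zero h0'),
      h, hsup]

/-- Equal bodies have equal second parts `λ₂ = μ₂`. [folklore] -/
private theorem secondPart_eq_of_erase_sup_eq {D D' : ℕ} {mu : Nat.Partition D} {lam : Nat.Partition D'}
    (h : mu.parts.erase mu.parts.sup = lam.parts.erase lam.parts.sup) :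
    secondPart mu = secondPart lam := by
  unfold secondPart
  rw [h]

/-- Equal bodies have equal body sizes `|λ̄| = |μ̄|`. [folklore] -/
private theorem bodySize_eq_of_erase_sup_eq {D D' : ℕ} {mu : Nat.Partition D} {lam : Nat.Partition D'}
    (h : mu.parts.erase mu.parts.sup = lam.parts.erase lam.parts.sup) :
    bodySize mu = bodySize lam := by
  rw [← sum_erase_sup_eq_bodySize, ← sum_erase_sup_eq_bodySize, h]

/-- `λ₂ ≤ λ₁`: the second part is at most the largest part. [folklore] -/
private theorem secondPart_le_sup {D : ℕ} (lam : Nat.Partition D) : secondPart lam ≤ lam.parts.sup :=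
  Multiset.sup_le.mpr fun _ ha => Multiset.le_sup (Multiset.mem_of_mem_erase ha)

variable (N : ℕ)

/-- **`HWV_λ(Sym^d Sym^n V)` in the coordinate-ring convention**: the forms of degree `d` on
`Sym^n V^*`, `V = ℂ^{N×N}` (elements of `ℂ[Sym^n] = MvPolynomial (DegIdx (MatIdx N) n) ℂ`
homogeneous of degree `d` in the coordinates) which are highest-weight vectors of weight `λ^*`
(`partitionWeightLex N λ`) — the hypotheses `IsHomogeneous d` ∧ `∈ highestWeightSpace …` of the
tree's facts `bip2019_prop_5_6_2`/`bip2019_prop_5_8_2`, as a submodule. BIP §4: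
"`a_λ(d[n]) := dim HWV_λ(Sym^d Sym^n V)`". [cite: BurgisserIkenmeyerPanovaJAMS2019, §4] -/
noncomputable def hwvForms (n d : ℕ) {D : ℕ} (lam : Nat.Partition D) :
    Submodule ℂ (MvPolynomial (DegIdx (MatIdx N) n) ℂ) :=
  MvPolynomial.homogeneousSubmodule (DegIdx (MatIdx N) n) ℂ d ⊓
    highestWeightSpace (coordRep (MatIdx N) ℂ n) (partitionWeightLex N lam)

/-- Membership in `hwvForms` (unfolding lemma). [cite: BurgisserIkenmeyerPanovaJAMS2019, §4] -/
theorem mem_hwvForms_iff {n d D : ℕ} (lam : Nat.Partition D)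
    (h : MvPolynomial (DegIdx (MatIdx N) n) ℂ) :
    h ∈ hwvForms N n d lam ↔ h.IsHomogeneous d ∧
      h ∈ highestWeightSpace (coordRep (MatIdx N) ℂ n) (partitionWeightLex N lam) := by
  rw [hwvForms, Submodule.mem_inf, MvPolynomial.mem_homogeneousSubmodule]

end Bookkeeping

/-! ### Prop. 5.6(1): the inner degree lifting is an isomorphism on highest-weight vectors -/

section Prop561

variable {k : Type*} [Field k] {σ : Type*} [Fintype σ] [DecidableEq σ]

/-- The dual inner lifting preserves forms of degree `D` (every coordinate goes to a linear
combination of coordinates). [cite: BurgisserIkenmeyerPanovaJAMS2019, §5(b) (5.3)] -/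
theorem isHomogeneous_innerLift (i : σ) {m n D : ℕ} {f : MvPolynomial (DegIdx σ m) k}
    (hf : f.IsHomogeneous D) : (innerLift i m n f).IsHomogeneous D := by
  unfold innerLift
  rw [← one_mul D]
  refine hf.aeval _ fun d => ?_
  refine MvPolynomial.IsHomogeneous.sum _ _ _ fun e _ => ?_
  rw [smul_eq_C_mul]
  exact (isHomogeneous_X k _).C_mul _

variable (N : ℕ) [NeZero N]

/-- **BIP Prop. 5.6(1) (plethysm stability under the inner degree lifting, isomorphism form), as
printed.** "(1) Suppose `μ ⊢ md` is such that `μ₂ ≤ m` and let `n ≥ m`. Then the inner degree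
lifting `κ^d_{m,n}` defines an isomorphism `HWV_μ(Sym^d Sym^m V) → HWV_{μ♯dn}(Sym^d Sym^n V),
f ↦ κ^d_{m,n}(f)`." [tex:1604.06431 L1898–1906; held arXiv v1 text `paper:arxiv-1604.06431`
Proposition 24, p0014.txt:L99–L107 (v1 states it for the FOCS lifting, corrected in v3, cf. the
remark after Thm. 5.4)]. Rendering (vocabulary of `bip2019_prop_5_6_2`): `V = ℂ^{N×N}`, inner
degrees `m' ≤ n'`, `μ ⊢ d·m'` with at most `N²` parts (automatic in print) and `μ₂ ≤ m'`;
`λ = μ♯dn'` is any `λ ⊢ d·n'` with the same body, `λ̄ = μ̄` (it is then `μ♯dn'`; `ℓ(λ) ≤ N²`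
automatic in print); `κ` is the tree's dual lifting `innerLift (topMatIdx N) m' n'` (BIP's `κ` up
to the nonzero factor `(m'!/n'!)^d`); "defines an isomorphism" = `innerLift` (injective,
`innerLift_injective`) maps `HWV_μ(Sym^d Sym^{m'} V)` ONTO `HWV_λ(Sym^d Sym^{n'} V)`
(`hwvForms`), i.e. the image submodule IS the target. Proof: `⊆` by Lemma 5.3
(`innerLift_mem_highestWeightSpace`: the weight shifts by `-(n'-m')d ε_top`, and
`μ^* = λ^* + (n'-m')d ε_top`, `partitionWeightLex_lowerTop`); `⊇` is the discharged Prop. 5.6(2)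
(`bip2019_prop_5_6_2_holds`: `λ₂ = μ₂ ≤ m'`, `λ₂ + |λ̄| = μ₂ + |μ̄| ≤ |μ| = m'd`), the partition it
returns being `μ` (`partition_eq_of_erase_sup_eq`). `-- DISCHARGEABLE` (proved here).
[cite: BurgisserIkenmeyerPanovaJAMS2019, Prop. 5.6 (1)] -/
theorem bip2019_prop_5_6_1 (m' n' d : ℕ) (hmn : m' ≤ n') (mu : Nat.Partition (d * m'))
    (hmu : mu.parts.card ≤ N * N) (h₂ : secondPart mu ≤ m') (lam : Nat.Partition (d * n'))
    (hlam : lam.parts.card ≤ N * N)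
    (hbody : lam.parts.erase lam.parts.sup = mu.parts.erase mu.parts.sup) :
    Submodule.map (innerLift (topMatIdx N) m' n').toLinearMap (hwvForms N m' d mu) =
      hwvForms N n' d lam := by
  classical
  set iₘ := topMatIdx N with hiₘ'
  have hiₘ : ∀ i, i ≤ iₘ := le_topMatIdx N
  -- bookkeeping: `λ₂ = μ₂`, `|λ̄| = |μ̄|`, `μ = lowerTop λ ((n'-m') d)`
  have hsec : secondPart lam = secondPart mu := secondPart_eq_of_erase_sup_eq hbody
  have hbs : bodySize lam = bodySize mu := bodySize_eq_of_erase_sup_eq hbody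
  have hsumm := sup_add_bodySize mu
  have hsuml := sup_add_bodySize lam
  have hsecm := secondPart_add_sup_le mu
  have h2le : secondPart mu ≤ mu.parts.sup := secondPart_le_sup mu
  have hcomm : m' * d = d * m' := Nat.mul_comm _ _
  have hsplit : (n' - m') * d + d * m' = d * n' := by
    rw [mul_comm d m', ← add_mul, Nat.sub_add_cancel hmn, mul_comm]
  have hr : secondPart lam + (n' - m') * d ≤ lam.parts.sup := by omega
  have hD : d * m' + (n' - m') * d = d * n' := by omega
  have hbody' : secondPart lam + bodySize lam ≤ m' * d := by omega
  have hmul : mu = lowerTop lam ((n' - m') * d) (d * m') hD hr :=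
    partition_eq_of_erase_sup_eq (by rw [erase_sup_lowerTop, hbody])
  have hwt : partitionWeightLex N mu = partitionWeightLex N lam + Pi.single iₘ (((n' - m') * d : ℕ) : ℤ) := by
    rw [hmul, partitionWeightLex_lowerTop]
  apply le_antisymm
  · -- `⊆`: Lemma 5.3
    rintro _ ⟨f, hf, rfl⟩
    rw [SetLike.mem_coe, mem_hwvForms_iff] at hf
    rw [mem_hwvForms_iff]
    refine ⟨isHomogeneous_innerLift iₘ hf.1, ?_⟩
    have h := innerLift_mem_highestWeightSpace iₘ hiₘ hmn hf.1 hf.2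
    rwa [hwt, add_assoc, ← Pi.single_add, add_neg_cancel, Pi.single_zero, add_zero] at h
  · -- `⊇`: Prop. 5.6(2)
    intro h hh
    rw [mem_hwvForms_iff] at hh
    obtain ⟨mu', f, hmu', hb', hf, hfw, hfh⟩ :=
      bip2019_prop_5_6_2_holds N m' n' d hmn lam hlam (by omega) hbody' h hh.1 hh.2
    have hmu' : mu' = mu := partition_eq_of_erase_sup_eq (by rw [hb', hbody])
    subst hmu'
    exact ⟨f, (mem_hwvForms_iff N mu' f).mpr ⟨hf, hfw⟩, hfh.symm⟩

/-- **Stability of the plethysm coefficient under the inner degree lifting** (BIP §5, first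
paragraph: "these liftings provide isomorphisms of the spaces of highest weight vectors. In
particular, the multiplicity `a_μ(d[m])` does not increase, which is known as the stability
property of the plethysm coefficients [Weintraub, Carré–Thibon, Manivel]"): under the hypotheses
of Prop. 5.6(1), `dim HWV_μ(Sym^d Sym^{m'} V) = dim HWV_{μ♯dn'}(Sym^d Sym^{n'} V)`.
[cite: BurgisserIkenmeyerPanovaJAMS2019, Prop. 5.6 (1)] -/
theorem bip2019_prop_5_6_1_finrank (m' n' d : ℕ) (hmn : m' ≤ n') (mu : Nat.Partition (d * m'))
    (hmu : mu.parts.card ≤ N * N) (h₂ : secondPart mu ≤ m') (lam : Nat.Partition (d * n'))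
    (hlam : lam.parts.card ≤ N * N)
    (hbody : lam.parts.erase lam.parts.sup = mu.parts.erase mu.parts.sup) :
    Module.finrank ℂ (hwvForms N m' d mu) = Module.finrank ℂ (hwvForms N n' d lam) := by
  have e := Submodule.equivMapOfInjective (innerLift (k := ℂ) (topMatIdx N) m' n').toLinearMap
    (innerLift_injective (topMatIdx N) hmn) (hwvForms N m' d mu)
  rw [bip2019_prop_5_6_1 N m' n' d hmn mu hmu h₂ lam hlam hbody] at e
  exact e.finrank_eq

/-- **The isomorphism of Prop. 5.6(1) itself**: `κ^d_{m,n}` (the dual lifting `innerLift`)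
as a linear equivalence `HWV_μ(Sym^d Sym^{m'} V) ≃ HWV_{μ♯dn'}(Sym^d Sym^{n'} V)`, assembled from
`innerLift_injective` and `bip2019_prop_5_6_1`. [cite: BurgisserIkenmeyerPanovaJAMS2019, Prop. 5.6 (1)] -/
noncomputable def bip2019_prop_5_6_1_equiv (m' n' d : ℕ) (hmn : m' ≤ n')
    (mu : Nat.Partition (d * m')) (hmu : mu.parts.card ≤ N * N) (h₂ : secondPart mu ≤ m')
    (lam : Nat.Partition (d * n')) (hlam : lam.parts.card ≤ N * N)
    (hbody : lam.parts.erase lam.parts.sup = mu.parts.erase mu.parts.sup) :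
    hwvForms N m' d mu ≃ₗ[ℂ] hwvForms N n' d lam :=
  (Submodule.equivMapOfInjective (innerLift (k := ℂ) (topMatIdx N) m' n').toLinearMap
      (innerLift_injective (topMatIdx N) hmn) (hwvForms N m' d mu)).trans
    (LinearEquiv.ofEq _ _ (bip2019_prop_5_6_1 N m' n' d hmn mu hmu h₂ lam hlam hbody))

/-- The isomorphism of Prop. 5.6(1) is `f ↦ κ(f) = innerLift f`. [cite: BurgisserIkenmeyerPanovaJAMS2019, Prop. 5.6 (1)] -/
theorem bip2019_prop_5_6_1_equiv_apply (m' n' d : ℕ) (hmn : m' ≤ n')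
    (mu : Nat.Partition (d * m')) (hmu : mu.parts.card ≤ N * N) (h₂ : secondPart mu ≤ m')
    (lam : Nat.Partition (d * n')) (hlam : lam.parts.card ≤ N * N)
    (hbody : lam.parts.erase lam.parts.sup = mu.parts.erase mu.parts.sup) (f : hwvForms N m' d mu) :
    (bip2019_prop_5_6_1_equiv N m' n' d hmn mu hmu h₂ lam hlam hbody f :
        MvPolynomial (DegIdx (MatIdx N) n') ℂ) = innerLift (topMatIdx N) m' n' (f : MvPolynomial (DegIdx (MatIdx N) m') ℂ) :=
  rfl

end Prop561

/-! ### Prop. 5.8(1): the outer degree lifting is an isomorphism on highest-weight vectors -/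

section Prop581

variable (N : ℕ) [NeZero N]

/-- **BIP Prop. 5.8(1) (plethysm stability under the outer degree lifting, isomorphism form), as
printed.** "(1) Suppose `ν ⊢ mk` such that `ν₂ + |ν̄| ≤ k` and let `d ≥ k`. The lifting (5.8)
defines an isomorphism `HWV_ν(Sym^k Sym^m V) → HWV_{ν♯dm}(Sym^d Sym^m V)`", where (5.8) is
`Sym^k Sym^m V → Sym^d Sym^m V, f ↦ (e_1^m)^{d-k} · f`. [tex:1604.06431 L2026–2034, (5.8)
L1955–1963; held arXiv v1 text `paper:arxiv-1604.06431` Proposition 29, p0017.txt:L3–L10].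
Rendering (vocabulary of `bip2019_prop_5_8_2`): `V = ℂ^{N×N}`, inner degree `s`, `ν ⊢ k'·s` with at
most `N²` parts and `ν₂ + |ν̄| ≤ k' ≤ d`; `μ = ν♯dm` is any `μ ⊢ d·s` with `μ̄ = ν̄`; `e_1^m` is the
coordinate `X (topDegIdx N s)` of `x_top^s` and (5.8) is left multiplication by its `(d-k')`-th
power (`LinearMap.mulLeft`, injective: `ℂ[Sym^s]` is a domain); "defines an isomorphism" = the image
of `HWV_ν(Sym^{k'} Sym^s V)` IS `HWV_μ(Sym^d Sym^s V)` (`hwvForms`). Proof: `⊆` since `GL` acts by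
algebra automorphisms (`mul_mem_highestWeightSpace_coordRep`, `X_mem_highestWeightSpace_coordRep`:
`X_{x_top^s}` has weight `-s ε_top`, and `ν^* = μ^* + (d-k')s ε_top`); `⊇` is the discharged
Prop. 5.8(2) (`bip2019_prop_5_8_2_holds`), the partition it returns being `ν`
(`partition_eq_of_erase_sup_eq`). `-- DISCHARGEABLE` (proved here).
[cite: BurgisserIkenmeyerPanovaJAMS2019, Prop. 5.8 (1)] -/
theorem bip2019_prop_5_8_1 (s d k' : ℕ) (hkd : k' ≤ d) (nu : Nat.Partition (k' * s))
    (hnu : nu.parts.card ≤ N * N) (hk : secondPart nu + bodySize nu ≤ k') (mu : Nat.Partition (d * s))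
    (hmu : mu.parts.card ≤ N * N)
    (hbody : mu.parts.erase mu.parts.sup = nu.parts.erase nu.parts.sup) :
    Submodule.map (LinearMap.mulLeft ℂ
        ((X (topDegIdx N s) : MvPolynomial (DegIdx (MatIdx N) s) ℂ) ^ (d - k')))
      (hwvForms N s k' nu) = hwvForms N s d mu := by
  classical
  set iₘ := topMatIdx N with hiₘ'
  have hiₘ : ∀ i, i ≤ iₘ := le_topMatIdx N
  set e₀ := topDegIdx N s with he₀'
  -- bookkeeping
  have hsec : secondPart mu = secondPart nu := secondPart_eq_of_erase_sup_eq hbody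
  have hbs : bodySize mu = bodySize nu := bodySize_eq_of_erase_sup_eq hbody
  have hsumn := sup_add_bodySize nu
  have hsumm := sup_add_bodySize mu
  have hsecn := secondPart_add_sup_le nu
  have hsplit : (d - k') * s + k' * s = d * s := by rw [← add_mul, Nat.sub_add_cancel hkd]
  have h2le : secondPart nu ≤ nu.parts.sup := secondPart_le_sup nu
  have hr : secondPart mu + (d - k') * s ≤ mu.parts.sup := by omega
  have hD : k' * s + (d - k') * s = d * s := by omega
  have hnul : nu = lowerTop mu ((d - k') * s) (k' * s) hD hr :=
    partition_eq_of_erase_sup_eq (by rw [erase_sup_lowerTop, hbody])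
  have hwt : partitionWeightLex N nu = partitionWeightLex N mu + Pi.single iₘ (((d - k') * s : ℕ) : ℤ) := by
    rw [hnul, partitionWeightLex_lowerTop]
  -- the multiplier `X_{x_top^s}^{d-k'}`
  have hX : (X e₀ : MvPolynomial (DegIdx (MatIdx N) s) ℂ) ∈
      highestWeightSpace (coordRep (MatIdx N) ℂ s) (Pi.single iₘ (-(s : ℤ))) :=
    X_mem_highestWeightSpace_coordRep s iₘ hiₘ e₀ rfl
  have hXp := pow_mem_highestWeightSpace_coordRep hX (d - k')
  have hw : (d - k') • Pi.single iₘ (-(s : ℤ)) + partitionWeightLex N nu = partitionWeightLex N mu := by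
    rw [hwt]
    funext j
    simp only [Pi.add_apply, Pi.smul_apply, Pi.single_apply]
    split_ifs <;> push_cast <;> ring
  apply le_antisymm
  · -- `⊆`
    rintro _ ⟨g, hg, rfl⟩
    rw [SetLike.mem_coe, mem_hwvForms_iff] at hg
    rw [LinearMap.mulLeft_apply, mem_hwvForms_iff]
    refine ⟨?_, ?_⟩
    · have := ((isHomogeneous_X ℂ e₀).pow (d - k')).mul hg.1
      rwa [one_mul, Nat.sub_add_cancel hkd] at this
    · have := mul_mem_highestWeightSpace_coordRep hXp hg.2
      rwa [hw] at this
  · -- `⊇`: Prop. 5.8(2)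
    intro f hf
    rw [mem_hwvForms_iff] at hf
    have hk' : secondPart mu + bodySize mu ≤ k' := by rw [hsec, hbs]; exact hk
    obtain ⟨nu', g, hnu', hb', hg, hgw, hfg⟩ :=
      bip2019_prop_5_8_2_holds N s d k' mu hmu hk' hkd f hf.1 hf.2
    have hnu'' : nu' = nu := partition_eq_of_erase_sup_eq (by rw [hb', hbody])
    subst hnu''
    exact ⟨g, (mem_hwvForms_iff N nu' g).mpr ⟨hg, hgw⟩, by rw [LinearMap.mulLeft_apply, hfg]⟩

/-- **Stability of the plethysm coefficient under the outer degree lifting** (BIP, remark after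
Prop. 5.8: "the stability of plethysm in Proposition 5.8(1) … was first shown in [Manivel 1998]
with a geometric method"): under the hypotheses of Prop. 5.8(1),
`dim HWV_ν(Sym^{k'} Sym^s V) = dim HWV_{ν♯ds}(Sym^d Sym^s V)`.
[cite: BurgisserIkenmeyerPanovaJAMS2019, Prop. 5.8 (1)] -/
theorem bip2019_prop_5_8_1_finrank (s d k' : ℕ) (hkd : k' ≤ d) (nu : Nat.Partition (k' * s))
    (hnu : nu.parts.card ≤ N * N) (hk : secondPart nu + bodySize nu ≤ k') (mu : Nat.Partition (d * s))
    (hmu : mu.parts.card ≤ N * N)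
    (hbody : mu.parts.erase mu.parts.sup = nu.parts.erase nu.parts.sup) :
    Module.finrank ℂ (hwvForms N s k' nu) = Module.finrank ℂ (hwvForms N s d mu) := by
  have hX0 : ((X (topDegIdx N s) : MvPolynomial (DegIdx (MatIdx N) s) ℂ) ^ (d - k')) ≠ 0 :=
    pow_ne_zero _ (X_ne_zero _)
  have e := Submodule.equivMapOfInjective (LinearMap.mulLeft ℂ
      ((X (topDegIdx N s) : MvPolynomial (DegIdx (MatIdx N) s) ℂ) ^ (d - k')))
    (mul_right_injective₀ hX0) (hwvForms N s k' nu)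
  rw [bip2019_prop_5_8_1 N s d k' hkd nu hnu hk mu hmu hbody] at e
  exact e.finrank_eq

/-- **The isomorphism of Prop. 5.8(1) itself**: the outer lifting (5.8) `g ↦ (e_1^m)^{d-k} · g`
(multiplication by `X_{x_top^s}^{d-k'}`) as a linear equivalence
`HWV_ν(Sym^{k'} Sym^s V) ≃ HWV_{ν♯ds}(Sym^d Sym^s V)`, assembled from the injectivity of
multiplication by a nonzero polynomial and `bip2019_prop_5_8_1`.
[cite: BurgisserIkenmeyerPanovaJAMS2019, Prop. 5.8 (1)] -/
noncomputable def bip2019_prop_5_8_1_equiv (s d k' : ℕ) (hkd : k' ≤ d) (nu : Nat.Partition (k' * s))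
    (hnu : nu.parts.card ≤ N * N) (hk : secondPart nu + bodySize nu ≤ k') (mu : Nat.Partition (d * s))
    (hmu : mu.parts.card ≤ N * N)
    (hbody : mu.parts.erase mu.parts.sup = nu.parts.erase nu.parts.sup) :
    hwvForms N s k' nu ≃ₗ[ℂ] hwvForms N s d mu :=
  (Submodule.equivMapOfInjective (LinearMap.mulLeft ℂ
        ((X (topDegIdx N s) : MvPolynomial (DegIdx (MatIdx N) s) ℂ) ^ (d - k')))
      (mul_right_injective₀ (pow_ne_zero _ (X_ne_zero _))) (hwvForms N s k' nu)).trans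
    (LinearEquiv.ofEq _ _ (bip2019_prop_5_8_1 N s d k' hkd nu hnu hk mu hmu hbody))

/-- The isomorphism of Prop. 5.8(1) is `g ↦ X_{x_top^s}^{d-k'} · g`. [cite: BurgisserIkenmeyerPanovaJAMS2019, Prop. 5.8 (1)] -/
theorem bip2019_prop_5_8_1_equiv_apply (s d k' : ℕ) (hkd : k' ≤ d) (nu : Nat.Partition (k' * s))
    (hnu : nu.parts.card ≤ N * N) (hk : secondPart nu + bodySize nu ≤ k') (mu : Nat.Partition (d * s))
    (hmu : mu.parts.card ≤ N * N)
    (hbody : mu.parts.erase mu.parts.sup = nu.parts.erase nu.parts.sup) (g : hwvForms N s k' nu) :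
    (bip2019_prop_5_8_1_equiv N s d k' hkd nu hnu hk mu hmu hbody g : MvPolynomial (DegIdx (MatIdx N) s) ℂ) =
      X (topDegIdx N s) ^ (d - k') * (g : MvPolynomial (DegIdx (MatIdx N) s) ℂ) :=
  rfl

end Prop581

/-! ### Prop. 7.2 (short-column hook-like shapes): named fact, discharged below -/

section Prop72

/-- **BIP Prop. 7.2 (positivity of the plethysm coefficients of the hook-like shapes with a short
column, `t ≥ r`), as a named fact in weight form.** Verbatim (arXiv v3 = JAMS): "7.2. Proposition.
Let `t ≥ r`, `i ≥ 2t+3` be positive integers and let `n ≥ i` and `d ≥ 2t+i+1`. Let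
`ν = (t+1) × i + (r+1) × 1 + (j)`, where `j = dn - (t+1)i - (r+1)`. Then `a_ν(d[n]) > 0`."
[tex:1604.06431 L2529–2532; held arXiv v1 text `paper:arxiv-1604.06431` Proposition 36,
p0021.txt:L76–L78]. Rendering EXACTLY as the sibling fact
`Literature.Computability.Complexity.bip2019_prop_7_3` (Prop. 7.3, discharged by
`bip2019_prop_7_3_holds`): `a_λ(d[n]) := dim HWV_λ(Sym^d Sym^n V)` (§4) for `V = ℂ^{N×N}` with
at least `ℓ(ν) = t + 1` basis vectors (`t ≥ r`; the printed tableau uses the letters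
`X_1, …, X_{t+1}`), `Sym^d Sym^n V` = the forms of degree `d` of
`ℂ[Sym^n] = MvPolynomial (DegIdx (MatIdx N) n) ℂ`, highest weight `ν ↔ partitionWeightLex N ν`,
`ν = hookPartition (r+1) (t+1) i (d n)` (`= (r+1) × 1 + (t+1) × i + 1 × j`, `OccurrenceObstructionsBIP.lean`);
positivity of `a_ν(d[n])` = existence of a NONZERO form of degree `d` in that highest-weight
space. "positive integers": `1 ≤ r ≤ t` (and `i ≥ 2t + 3 ≥ 5`). Not used by BIP's proof of
Thm. 6.2 beyond motivating Prop. 7.3; absent from the tree as a statement before this file.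
`-- FACT`, DISCHARGED below (`bip2019_prop_7_2_holds`): the printed proof is the explicit tableau of
Figure 1 (`β(k) = k + 1` cells of the label `k ≤ t` in row `k + 1`, the label `2t + 1 - k` filling
the rest of that row, Claim 7.1 with `D = 2t`), an instance of the tree's generic block-design
theorem `Literature.Computability.Complexity.exists_hwv_hookPartition_of_design`.
[cite: BurgisserIkenmeyerPanovaJAMS2019, Prop. 7.2] -/
def bip2019_prop_7_2 : Prop :=
  ∀ (N t r i n d : ℕ) [NeZero N] (_hr : 0 < r) (_hrt : r ≤ t) (_hi : 2 * t + 3 ≤ i)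
    (_hn : i ≤ n) (_hd : 2 * t + i + 1 ≤ d) (_hN : t + 1 ≤ N * N),
    ∃ h : MvPolynomial (DegIdx (MatIdx N) n) ℂ, h ≠ 0 ∧ h.IsHomogeneous d ∧
      h ∈ highestWeightSpace (coordRep (MatIdx N) ℂ n)
        (Literature.Computability.Complexity.partitionWeightLex N
          (Literature.Computability.Complexity.hookPartition (r + 1) (t + 1) i (d * n)))

end Prop72

/-! ### Discharge of Prop. 7.2 by the printed tableau (a block design) -/

section Prop72Discharge

/-- The block rows of the printed tableau of BIP Prop. 7.2 (Figure 1), 0-indexed: the label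
`u < t` (BIP's `k = u + 1`) lies in block row `u` (BIP's row `k + 1`), and the label
`t ≤ u < 2t` (BIP's `2t + 1 - k`, `k = 2t - u`) lies in block row `2t - 1 - u` (BIP's row
`k + 1`): "if `1 ≤ k ≤ r`, the row `k+1` of `T` has `i+1` boxes: `k+1` boxes are labeled `k`, and
the remaining `i-k` boxes are labeled `2t+1-k`. If `r < k ≤ t`, then the row `k+1` of `T` has `i`
boxes: `k+1` boxes are labeled `k` and the remaining `i-k-1` boxes labeled `2t+1-k`."
[cite: BurgisserIkenmeyerPanovaJAMS2019, Prop. 7.2 (proof)] -/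
def p72Row (t u : ℕ) : ℕ := if u < t then u else 2 * t - 1 - u

/-- The block multiplicities of the printed tableau of BIP Prop. 7.2 (the number of cells of the
label in its block row, the hanging first-column cell of the labels `u < r` NOT counted, as in
`Literature.Computability.Complexity.exists_hwv_hookPartition_of_design`): `β(u+1) - [u < r] =
u + 2 - [u < r]` for `u < t`, and `i - k - [k > r]` for `u = 2t - k ≥ t`; so the sizes
`mul u + [u < r]` are BIP's `2 ≤ β(1) < β(2) < ⋯ < β(2t)`, namely `2, 3, …, t+1` and then
`i - t - [t > r], …, i - 1`. [cite: BurgisserIkenmeyerPanovaJAMS2019, Prop. 7.2 (proof)] -/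
def p72Mul (t r i u : ℕ) : ℕ :=
  if u < t then (if u < r then u + 1 else u + 2)
  else i - (2 * t - u) - (if r < 2 * t - u then 1 else 0)

variable {t r i : ℕ}

/-- **The block rows of the Prop. 7.2 tableau have length `i`**: block row `j < t` carries the two
labels `j` and `2t - 1 - j` with `(j + 2 - [j < r]) + (i - (j+1) - [j+1 > r]) = i` block cells
(BIP: "`k+1` boxes are labeled `k`, and the remaining `i-k` [resp. `i-k-1`] boxes are labeled
`2t+1-k`"). [cite: BurgisserIkenmeyerPanovaJAMS2019, Prop. 7.2 (proof)] -/
theorem p72_rowsum (hi : 2 * t + 3 ≤ i) {j : ℕ} (hj : j < t) :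
    ∑ u ∈ (Finset.range (2 * t)).filter (fun u => p72Row t u = j), p72Mul t r i u = i := by
  have h1 : ∑ u ∈ Finset.range t, (if p72Row t u = j then p72Mul t r i u else 0) =
      p72Mul t r i j := by
    rw [Finset.sum_eq_single_of_mem j (Finset.mem_range.mpr hj)]
    · rw [if_pos]
      unfold p72Row
      rw [if_pos hj]
    · intro u hu hne
      rw [Finset.mem_range] at hu
      rw [if_neg]
      unfold p72Row
      rw [if_pos hu]
      exact hne
  have h2 : ∑ x ∈ Finset.range t, (if p72Row t (t + x) = j then p72Mul t r i (t + x) else 0) =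
      p72Mul t r i (2 * t - 1 - j) := by
    rw [Finset.sum_eq_single_of_mem (t - 1 - j) (Finset.mem_range.mpr (by omega))]
    · have ht : t + (t - 1 - j) = 2 * t - 1 - j := by omega
      rw [if_pos, ht]
      unfold p72Row
      rw [if_neg (by omega)]
      omega
    · intro x hx hne
      rw [Finset.mem_range] at hx
      rw [if_neg]
      unfold p72Row
      rw [if_neg (by omega)]
      omega
  rw [Finset.sum_filter, two_mul, Finset.sum_range_add, h1, h2]
  unfold p72Mul
  split_ifs <;> omega

/-- **Discharge of `bip2019_prop_7_2` — BIP Prop. 7.2, by its printed proof.** The printed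
tableau (Figure 1 / "Formally, …") is the block design `p72Row`/`p72Mul` with `K = D = 2t` block
labels: rows of length `i` (`p72_rowsum`), sizes `β(u)` pairwise distinct, `≥ 2` and `≤ i - 1 ≤ n`,
and `K + i + 1 = 2t + i + 1 ≤ d` — exactly the printed hypotheses `i ≥ 2t + 3` (which makes
`β(t+1) = i - t - [t > r] > t + 1 = β(t)`), `n ≥ i`, `d ≥ 2t + i + 1`; the tree's generic
block-design theorem `Literature.Computability.Complexity.exists_hwv_hookPartition_of_design`
(BIP §7: Claim 7.1 with `|C¹_u| = n - β(u)`, the row tensor `Φ`, Thm. 4.7; every respecting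
bijection of nonzero value contributes `+1`) then gives a nonzero highest-weight vector of weight
`ν`. [cite: BurgisserIkenmeyerPanovaJAMS2019, Prop. 7.2] -/
theorem bip2019_prop_7_2_holds : bip2019_prop_7_2 := by
  intro N t r i n d _ hr hrt hi hn hd hN
  have ht : 0 < t := lt_of_lt_of_le hr hrt
  refine Literature.Computability.Complexity.exists_hwv_hookPartition_of_design
    (K := 2 * t) (row := p72Row t) (mul := p72Mul t r i) N ht hr (by omega)
    (fun u _ => ?_) (fun u _ hut => ?_) (fun j hj => p72_rowsum hi hj)
    (fun u v hu hv h => ?_) (fun u _ => ?_) (fun u hu => ?_) (by omega) ?_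
  · unfold p72Row
    split_ifs <;> omega
  · unfold p72Row
    rw [if_pos hut]
  · revert h
    unfold p72Mul
    split_ifs <;> omega
  · unfold p72Mul
    split_ifs <;> omega
  · unfold p72Mul
    split_ifs <;> omega
  · rw [max_eq_right hrt]
    exact hN

end Prop72Discharge

end Literature.Computability.AlgebraicComplexity
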